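import Literature.GroupTheory.FiniteAbelian.SymplecticModulesPlane
import HarnessLib

/-!
# Symplectic modules II: a finite abelian group with a nondegenerate alternating `ℚ/ℤ`-pairing is `L × L`

Pure algebra (topic `Literature/GroupTheory/FiniteAbelian`): the classical structure theorem that
the sibling file `AlternatingPairing.lean` names but does not prove ("Classically such a `T` is
isomorphic to `M × M` … only the parity of the `p`-rank is proved here"). For a finite abelian group
`T` with a bi-additive, alternating, nondegenerate `B : T × T → ℚ/ℤ`:

* `exists_isCompl_isotropic_addEquiv` — **Wall 1963 Lemma 7 / Tignol–Amitsur 1986 Thm. 4.1**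
  ("Let `(A, φ)` be a symplectic module. There exists `B ≤ A` such that `(A, φ)` is isomorphic to
  `B × B^*`"): there are subgroups `L, L'` with `T = L ⊕ L'`, `B(L, L) = 0 = B(L', L')`, `L ≃+ L'`.
  Induction on `#T`: split off the hyperbolic plane through an element `x` of maximal order `n` and
  its partner `y` (`B(x, y) = 1/n`, file I), decompose `H^⊥ = L₀ ⊕ L₀'` by induction, and take
  `L = L₀ + ⟨x⟩`, `L' = L₀' + ⟨y⟩` (`L ≃ L₀ × ⟨x⟩ ≃ L₀' × ℤ/n ≃ L'`).
* `exists_lagrangian_sq_eq_card` (`L^⊥ = L`, `(#L)² = #T`), `exists_addEquiv_prod_self`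
  (`T ≃+ L × L`: elementary divisors come in pairs), `isSquare_natCard` (`#T` is a square — Cassels
  1962 for `Ш(E/K)`; the sibling file has only `#T[p] = p^{2k}`).
* The **equivariant refinement** used by McCallum 1991 §5 (pp. 307–308) for the eigenspaces
  `Ш(E/K)[p^∞]^±` of complex conjugation (`p` odd) is the sequel `SymplecticModulesInvolution.lean`.

References: [Wall1963QuadraticFormsFiniteGroups] Lemma 7; [TignolAmitsur1986SymplecticModules]
Thm. 4.1 (both as quoted in the held text arXiv:1604.07227, §2 Cor. 1); [McCallumLMS1991] §5
(pp. 307–308, held chunk p0284). Conventions as in file I (`AddCircle (1 : ℚ)`, curried `→+`, left nondegeneracy, theorems only,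
no definitions, no named fact; D-0026).
-/

noncomputable section

open AddSubgroup

namespace Literature.GroupTheory.FiniteAbelian

universe u v

section Symplectic

variable {T : Type u} [AddCommGroup T] (B : T →+ T →+ AddCircle (1 : ℚ))

/-- For an alternating pairing, `B(x, y) = 0 ↔ B(y, x) = 0`. [folklore] -/
private theorem apply_eq_zero_comm_of_alternating {Q : Type v} [AddCommGroup Q]
    (B : T →+ T →+ Q) (halt : ∀ x, B x x = 0) (x y : T) : B x y = 0 ↔ B y x = 0 := by
  have h := halt (x + y)
  simp only [map_add, AddMonoidHom.add_apply, halt x, halt y, zero_add, add_zero] at h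
  rw [eq_neg_of_add_eq_zero_right h, neg_eq_zero]

/-- The sum map `L × L' → T` of two disjoint subgroups is injective. [folklore] -/
private theorem injective_coprod_subtype_of_disjoint {L L' : AddSubgroup T} (h : Disjoint L L') :
    Function.Injective (L.subtype.coprod L'.subtype) := by
  rw [injective_iff_map_eq_zero]
  rintro ⟨a, b⟩ hab
  rw [AddMonoidHom.coprod_apply, coe_subtype, coe_subtype] at hab
  have ha : (a : T) ∈ L' := by
    have : (a : T) = -(b : T) := eq_neg_of_add_eq_zero_left hab
    rw [this]
    exact L'.neg_mem b.2
  have ha0 : (a : T) = 0 := (AddSubgroup.disjoint_def.mp h) a.2 ha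
  have hb0 : (b : T) = 0 := by rwa [ha0, zero_add] at hab
  ext <;> simp [ha0, hb0]

/-- The sum map `L × L' → T` of two subgroups has range `L ⊔ L'`. [folklore] -/
private theorem range_coprod_subtype (L L' : AddSubgroup T) :
    (L.subtype.coprod L'.subtype).range = L ⊔ L' := by
  ext t
  simp only [AddMonoidHom.mem_range, AddMonoidHom.coprod_apply, coe_subtype, Prod.exists,
    Subtype.exists, exists_prop, AddSubgroup.mem_sup]

/-- Two complementary subgroups `L, L'` of an abelian group give `T ≃+ L × L'` (the sum map is
bijective). [folklore] -/
private theorem nonempty_addEquiv_prod_of_isCompl {L L' : AddSubgroup T} (h : IsCompl L L') :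
    Nonempty (T ≃+ L × L') := by
  refine ⟨(AddEquiv.ofBijective (L.subtype.coprod L'.subtype)
    ⟨injective_coprod_subtype_of_disjoint h.disjoint, ?_⟩).symm⟩
  rw [← AddMonoidHom.range_eq_top, range_coprod_subtype]
  exact h.codisjoint.eq_top

/-- Two *disjoint* subgroups `L₁, L₂` of an abelian group: `L₁ × L₂ ≃+ L₁ ⊔ L₂`. [folklore] -/
private theorem nonempty_prod_addEquiv_sup_of_disjoint {L₁ L₂ : AddSubgroup T} (h : Disjoint L₁ L₂) :
    Nonempty (L₁ × L₂ ≃+ ↥(L₁ ⊔ L₂)) :=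
  ⟨(AddMonoidHom.ofInjective (injective_coprod_subtype_of_disjoint h)).trans
    (AddEquiv.addSubgroupCongr (range_coprod_subtype L₁ L₂))⟩

/-- Adjoining an orthogonal isotropic element to an isotropic subgroup keeps it isotropic: if
`B(L₁, L₁) = 0` and `B(L₁, x) = 0` (with `B` alternating) then `B` vanishes on `L₁ + ⟨x⟩`.
[folklore] -/
private theorem isotropic_sup_zmultiples {Q : Type v} [AddCommGroup Q] (B : T →+ T →+ Q)
    (halt : ∀ x, B x x = 0) {L₁ : AddSubgroup T} {x : T} (hL : ∀ a ∈ L₁, ∀ b ∈ L₁, B a b = 0)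
    (hx : ∀ a ∈ L₁, B a x = 0) :
    ∀ a ∈ L₁ ⊔ zmultiples x, ∀ b ∈ L₁ ⊔ zmultiples x, B a b = 0 := by
  intro a ha b hb
  rw [AddSubgroup.mem_sup] at ha hb
  obtain ⟨a₁, ha₁, a₂, ha₂, rfl⟩ := ha
  obtain ⟨b₁, hb₁, b₂, hb₂, rfl⟩ := hb
  rw [AddSubgroup.mem_zmultiples_iff] at ha₂ hb₂
  obtain ⟨k, rfl⟩ := ha₂
  obtain ⟨m, rfl⟩ := hb₂
  have h1 : B a₁ (m • x) = 0 := by rw [map_zsmul, hx a₁ ha₁, smul_zero]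
  have h2 : B (k • x) b₁ = 0 := by
    rw [apply_eq_zero_comm_of_alternating B halt, map_zsmul, hx b₁ hb₁, smul_zero]
  have h3 : B (k • x) (m • x) = 0 := by
    rw [map_zsmul, map_zsmul, AddMonoidHom.zsmul_apply, halt x, smul_zero, smul_zero]
  simp only [map_add, AddMonoidHom.add_apply, hL a₁ ha₁ b₁ hb₁, h1, h2, h3, add_zero]

/-- **Wall 1963, Lemma 7 / Tignol–Amitsur 1986, Thm. 4.1 (symplectic modules are hyperbolic).**
A finite abelian group `T` with a nondegenerate alternating bi-additive pairing
`B : T × T → ℚ/ℤ` is the direct sum of two isotropic subgroups `L, L'` which are isomorphic as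
groups (a Lagrangian decomposition; `L' ≃ L^* = Hom(L, ℚ/ℤ) ≃ L`). Printed: "Let `(A, φ)` be a
symplectic module. There exists `B ≤ A` such that `(A, φ)` is isomorphic to `B × B^*`." Proof by
induction on `#T`, splitting off the hyperbolic plane through an element of maximal order
(`exists_apply_eq_coe_one_div`, `isCompl_hyperbolicPlane`).
[cite: Wall1963QuadraticFormsFiniteGroups, Lemma 7] [cite: TignolAmitsur1986SymplecticModules, Thm. 4.1] -/
theorem exists_isCompl_isotropic_addEquiv [Finite T] (halt : ∀ x, B x x = 0)
    (hnd : ∀ x, (∀ y, B x y = 0) → x = 0) :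
    ∃ L L' : AddSubgroup T, IsCompl L L' ∧ (∀ a ∈ L, ∀ b ∈ L, B a b = 0) ∧
      (∀ a ∈ L', ∀ b ∈ L', B a b = 0) ∧ Nonempty (L ≃+ L') := by
  suffices key : ∀ (k : ℕ) (T : Type u) [AddCommGroup T] [Finite T]
      (B : T →+ T →+ AddCircle (1 : ℚ)), (∀ x, B x x = 0) → (∀ x, (∀ y, B x y = 0) → x = 0) →
      Nat.card T = k →
      ∃ L L' : AddSubgroup T, IsCompl L L' ∧ (∀ a ∈ L, ∀ b ∈ L, B a b = 0) ∧
        (∀ a ∈ L', ∀ b ∈ L', B a b = 0) ∧ Nonempty (L ≃+ L') from key _ T B halt hnd rfl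
  intro k
  induction k using Nat.strong_induction_on with
  | _ k ih =>
  intro T _ _ B halt hnd hk
  by_cases htriv : Subsingleton T
  · -- `T = 0`: `L = L' = 0`
    refine ⟨⊥, ⊥, isCompl_iff.mpr ⟨disjoint_bot_left, codisjoint_iff.mpr ?_⟩, by simp, by simp,
      ⟨AddEquiv.refl _⟩⟩
    rw [bot_sup_eq]
    exact (AddSubgroup.eq_bot_of_subsingleton ⊤).symm
  rw [not_subsingleton_iff_nontrivial] at htriv
  -- an element `x` of maximal order `n ≥ 2`
  obtain ⟨x, hxmax⟩ := Finite.exists_max fun t : T ↦ addOrderOf t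
  set n : ℕ := addOrderOf x with hn_def
  have hn : 0 < n := addOrderOf_pos x
  have hn1 : n ≠ 1 := by
    intro h1
    obtain ⟨t, ht⟩ := exists_ne (0 : T)
    have ht1 : addOrderOf t = 1 := le_antisymm (h1 ▸ hxmax t) (addOrderOf_pos t)
    exact ht (AddMonoid.addOrderOf_eq_one_iff.mp ht1)
  set u : AddCircle (1 : ℚ) := ((((1 : ℚ) / n : ℚ)) : AddCircle (1 : ℚ)) with hu_def
  have hu0 : u ≠ 0 := by
    rw [← AddMonoid.addOrderOf_eq_one_iff.ne, hu_def, AddCircle.addOrderOf_period_div hn]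
    exact hn1
  -- its partner `y`, of order `n`
  obtain ⟨y, hxy⟩ := exists_apply_eq_coe_one_div B hnd x
  rw [← hn_def] at hxy
  have hx : n • x = 0 := addOrderOf_nsmul_eq_zero x
  have hyn : addOrderOf y = n := by
    refine le_antisymm (hxmax y) (Nat.le_of_dvd (addOrderOf_pos y) ?_)
    rw [← AddCircle.addOrderOf_period_div (p := (1 : ℚ)) hn, addOrderOf_dvd_iff_nsmul_eq_zero,
      ← hxy, ← map_nsmul,
      addOrderOf_nsmul_eq_zero, map_zero]
  have hy : n • y = 0 := hyn ▸ addOrderOf_nsmul_eq_zero y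
  -- the plane `H` and its orthogonal `Hp`
  obtain ⟨hdisj, hHc⟩ := isCompl_hyperbolicPlane B halt hn hx hy hxy
  set H : AddSubgroup T := zmultiples x ⊔ zmultiples y with hH_def
  set Hp : AddSubgroup T := (B.flip x).ker ⊓ (B.flip y).ker with hHp_def
  -- the restricted pairing
  set Bp : Hp →+ Hp →+ AddCircle (1 : ℚ) := (B.comp Hp.subtype).compl₂ Hp.subtype with hBp_def
  have hBp : ∀ a b : Hp, Bp a b = B a b := fun a b ↦ rfl
  have haltp : ∀ a : Hp, Bp a a = 0 := fun a ↦ by rw [hBp, halt]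
  have hndp : ∀ a : Hp, (∀ b : Hp, Bp a b = 0) → a = 0 :=
    nondegenerate_restrict_hyperbolicPlane B halt hnd hn hx hy hxy
  -- `#Hp < #T` since `x ∉ Hp`
  have hxHp : x ∉ Hp := by
    intro hxm
    rw [hHp_def, AddSubgroup.mem_inf, AddMonoidHom.mem_ker, AddMonoidHom.mem_ker,
      AddMonoidHom.flip_apply, AddMonoidHom.flip_apply] at hxm
    rw [hxy, ← hu_def] at hxm
    exact hu0 hxm.2
  have hcard : Nat.card Hp < k := by
    rw [← hk]
    refine lt_of_le_of_ne (Nat.le_of_dvd Nat.card_pos (AddSubgroup.card_addSubgroup_dvd_card Hp))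
      fun h ↦ hxHp ?_
    rw [(AddSubgroup.card_eq_iff_eq_top Hp).mp h]
    exact AddSubgroup.mem_top x
  -- induction
  obtain ⟨L₀, L₀', hc₀, hiso₀, hiso₀', ⟨e₀⟩⟩ := ih _ hcard Hp Bp haltp hndp rfl
  set L₁ : AddSubgroup T := L₀.map Hp.subtype with hL₁_def
  set L₁' : AddSubgroup T := L₀'.map Hp.subtype with hL₁'_def
  have hL₁le : L₁ ≤ Hp := AddSubgroup.map_subtype_le L₀
  have hL₁'le : L₁' ≤ Hp := AddSubgroup.map_subtype_le L₀'
  have hL₁inf : L₁ ⊓ L₁' = ⊥ := by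
    rw [hL₁_def, hL₁'_def, ← AddSubgroup.map_inf _ _ _ Hp.subtype_injective, hc₀.inf_eq_bot,
      AddSubgroup.map_bot]
  have hL₁sup : L₁ ⊔ L₁' = Hp := by
    rw [hL₁_def, hL₁'_def, ← AddSubgroup.map_sup, hc₀.sup_eq_top, ← AddMonoidHom.range_eq_map,
      AddSubgroup.range_subtype]
  have hisoL₁ : ∀ a ∈ L₁, ∀ b ∈ L₁, B a b = 0 := by
    intro a ha b hb
    obtain ⟨a₀, ha₀, rfl⟩ := AddSubgroup.mem_map.mp ha
    obtain ⟨b₀, hb₀, rfl⟩ := AddSubgroup.mem_map.mp hb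
    exact hiso₀ a₀ ha₀ b₀ hb₀
  have hisoL₁' : ∀ a ∈ L₁', ∀ b ∈ L₁', B a b = 0 := by
    intro a ha b hb
    obtain ⟨a₀, ha₀, rfl⟩ := AddSubgroup.mem_map.mp ha
    obtain ⟨b₀, hb₀, rfl⟩ := AddSubgroup.mem_map.mp hb
    exact hiso₀' a₀ ha₀ b₀ hb₀
  have hmemHp : ∀ t, t ∈ Hp ↔ B t x = 0 ∧ B t y = 0 := fun t ↦ by
    rw [hHp_def, AddSubgroup.mem_inf, AddMonoidHom.mem_ker, AddMonoidHom.mem_ker,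
      AddMonoidHom.flip_apply, AddMonoidHom.flip_apply]
  -- the Lagrangians
  refine ⟨L₁ ⊔ zmultiples x, L₁' ⊔ zmultiples y, isCompl_iff.mpr ⟨?_, ?_⟩,
    isotropic_sup_zmultiples B halt hisoL₁ fun a ha ↦ ((hmemHp a).mp (hL₁le ha)).1,
    isotropic_sup_zmultiples B halt hisoL₁' fun a ha ↦ ((hmemHp a).mp (hL₁'le ha)).2, ?_⟩
  · -- disjoint
    rw [AddSubgroup.disjoint_def]
    intro z hz hz'
    obtain ⟨a, ha, b, hb, rfl⟩ := AddSubgroup.mem_sup.mp hz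
    obtain ⟨a', ha', b', hb', he⟩ := AddSubgroup.mem_sup.mp hz'
    -- `a - a' = b' - b ∈ Hp ∩ H = 0`
    have h1 : a - a' ∈ Hp := Hp.sub_mem (hL₁le ha) (hL₁'le ha')
    have h2 : a - a' ∈ H := by
      have : a - a' = b' - b := by rw [sub_eq_sub_iff_add_eq_add, ← he, add_comm]
      rw [this]
      exact H.sub_mem (le_sup_right (a := zmultiples x) hb') (le_sup_left (b := zmultiples y) hb)
    have haa' : a = a' :=
      sub_eq_zero.mp ((AddSubgroup.disjoint_def.mp hHc.symm.disjoint) h1 h2)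
    subst haa'
    have ha0 : a = 0 := by
      have : a ∈ L₁ ⊓ L₁' := AddSubgroup.mem_inf.mpr ⟨ha, ha'⟩
      rwa [hL₁inf, AddSubgroup.mem_bot] at this
    subst ha0
    rw [zero_add] at he ⊢
    have hbb' : b = b' := by rw [zero_add] at he; exact he.symm
    subst hbb'
    exact (AddSubgroup.disjoint_def.mp hdisj) hb hb'
  · -- codisjoint
    rw [codisjoint_iff, sup_sup_sup_comm, hL₁sup, ← hH_def, sup_comm]
    exact hHc.sup_eq_top
  · -- `L ≃+ L'`
    have hd : Disjoint L₁ (zmultiples x) :=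
      hHc.symm.disjoint.mono hL₁le (le_sup_left (b := zmultiples y))
    have hd' : Disjoint L₁' (zmultiples y) :=
      hHc.symm.disjoint.mono hL₁'le (le_sup_right (a := zmultiples x))
    obtain ⟨e⟩ := nonempty_prod_addEquiv_sup_of_disjoint hd
    obtain ⟨e'⟩ := nonempty_prod_addEquiv_sup_of_disjoint hd'
    have hcyc : Nat.card (zmultiples x) = Nat.card (zmultiples y) := by
      rw [Nat.card_zmultiples, Nat.card_zmultiples, hyn]
    let exy : zmultiples x ≃+ zmultiples y := addEquivOfAddCyclicCardEq hcyc
    let e₁ : L₁ ≃+ L₀ := (AddSubgroup.equivMapOfInjective L₀ Hp.subtype Hp.subtype_injective).symm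
    let e₁' : L₀' ≃+ L₁' := AddSubgroup.equivMapOfInjective L₀' Hp.subtype Hp.subtype_injective
    exact ⟨e.symm.trans ((AddEquiv.prodCongr (e₁.trans (e₀.trans e₁')) exy).trans e')⟩

/-! ### Corollaries: Lagrangians, `T ≃ L × L`, `#T` is a square -/

/-- In a decomposition `T = L ⊕ L'` into isotropic subgroups of a nondegenerate pairing, `L` is a
**Lagrangian**: `L^⊥ = L`. [cite: TignolAmitsur1986SymplecticModules, Thm. 4.1] -/
theorem mem_of_forall_apply_eq_zero_of_isCompl {Q : Type v} [AddCommGroup Q] (B : T →+ T →+ Q)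
    (hnd : ∀ x, (∀ y, B x y = 0) → x = 0) {L L' : AddSubgroup T} (h : IsCompl L L')
    (hL : ∀ a ∈ L, ∀ b ∈ L, B a b = 0) (hL' : ∀ a ∈ L', ∀ b ∈ L', B a b = 0) {t : T}
    (ht : ∀ s ∈ L, B t s = 0) : t ∈ L := by
  have htop : ∀ w : T, w ∈ L ⊔ L' := fun w ↦ by rw [h.sup_eq_top]; exact AddSubgroup.mem_top w
  obtain ⟨a, ha, b, hb, hab⟩ := AddSubgroup.mem_sup.mp (htop t)
  have hb' : b = t - a := by rw [← hab, add_sub_cancel_left]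
  have hb0 : b = 0 := hnd b fun w ↦ by
    obtain ⟨c, hc, c', hc', rfl⟩ := AddSubgroup.mem_sup.mp (htop w)
    rw [map_add, hL' b hb c' hc', add_zero, hb', map_sub, AddMonoidHom.sub_apply, ht c hc,
      hL a ha c hc, sub_zero]
  rw [← hab, hb0, add_zero]
  exact ha

/-- **A symplectic module has a Lagrangian of order `√#T`**: there is an isotropic subgroup `L`
with `L^⊥ = L` and `(#L)² = #T` (Tignol–Amitsur: "any Lagrangian `L` of `A` is of cardinal
`√|A|`"). [cite: TignolAmitsur1986SymplecticModules, Thm. 4.1]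
[cite: Wall1963QuadraticFormsFiniteGroups, Lemma 7] -/
theorem exists_lagrangian_sq_eq_card [Finite T] (halt : ∀ x, B x x = 0)
    (hnd : ∀ x, (∀ y, B x y = 0) → x = 0) :
    ∃ L : AddSubgroup T, (∀ a ∈ L, ∀ b ∈ L, B a b = 0) ∧
      (∀ t, (∀ s ∈ L, B t s = 0) → t ∈ L) ∧ Nat.card L ^ 2 = Nat.card T := by
  obtain ⟨L, L', hc, hL, hL', ⟨e⟩⟩ := exists_isCompl_isotropic_addEquiv B halt hnd
  obtain ⟨f⟩ := nonempty_addEquiv_prod_of_isCompl hc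
  refine ⟨L, hL, fun t ht ↦ mem_of_forall_apply_eq_zero_of_isCompl B hnd hc hL hL' ht, ?_⟩
  rw [Nat.card_congr f.toEquiv, Nat.card_prod, ← Nat.card_congr e.toEquiv, sq]

/-- **`T ≃ M × M`** (the statement recorded as classical in `AlternatingPairing.lean`): a finite
abelian group with a nondegenerate alternating `ℚ/ℤ`-valued pairing is isomorphic to `L × L` for
an isotropic subgroup `L` — in particular its elementary divisors come in pairs.
[cite: Wall1963QuadraticFormsFiniteGroups, Lemma 7] [cite: TignolAmitsur1986SymplecticModules, Thm. 4.1] -/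
theorem exists_addEquiv_prod_self [Finite T] (halt : ∀ x, B x x = 0)
    (hnd : ∀ x, (∀ y, B x y = 0) → x = 0) :
    ∃ L : AddSubgroup T, (∀ a ∈ L, ∀ b ∈ L, B a b = 0) ∧ Nonempty (T ≃+ L × L) := by
  obtain ⟨L, L', hc, hL, -, ⟨e⟩⟩ := exists_isCompl_isotropic_addEquiv B halt hnd
  obtain ⟨f⟩ := nonempty_addEquiv_prod_of_isCompl hc
  exact ⟨L, hL, ⟨f.trans (AddEquiv.prodCongr (AddEquiv.refl L) e.symm)⟩⟩

/-- **The order of a symplectic module is a square** (for `T = Ш(E/K)` with the Cassels–Tate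
pairing: Cassels 1962; the sibling `exists_natCard_torsionBy_eq_pow_two_mul_of_circle` gives only
`#T[p] = p^{2k}`). [cite: Wall1963QuadraticFormsFiniteGroups, Lemma 7] -/
theorem isSquare_natCard [Finite T] (halt : ∀ x, B x x = 0)
    (hnd : ∀ x, (∀ y, B x y = 0) → x = 0) : IsSquare (Nat.card T) := by
  obtain ⟨L, -, -, h⟩ := exists_lagrangian_sq_eq_card B halt hnd
  exact ⟨Nat.card L, by rw [← h, sq]⟩

end Symplectic


end Literature.GroupTheory.FiniteAbelian

end
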